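import Literature.Topology.PlaneTopology.JordanLoopCornerTraverse
import Literature.Topology.PlaneTopology.CrosscutProofs
import HarnessLib

/-!
# The traverse of a Jordan loop around a corner is a cross-cut separating the corner from the far arc

Topic: Topology / PlaneTopology.  Continuation of `JordanLoopCornerTraverse.lean`.  For a Jordan
domain `Ω` with boundary loop `b`, parameters `m₁ < m < m₃ < m₁ + 1`, arcs `A₁ = b[m₁, m]`,
`A₂ = b[m, m₃]`, `A₀ = b[m₃, m₁ + 1]`, corner `c = b m`, and a Jordan loop `Γ` with `c` inside
and `A₀` outside:

* `exists_traverse` — **cross-cut traverse**: there are `u < v < u + 1` with `Γ (u, v) ⊆ Ω` and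
  `{Γ u, Γ v}` meeting `A₁` and `A₂` (trimming of the traverse of
  `exists_mem_mem_forall_uIcc_of_inside` by first-exit/last-entrance, `exists_trimmed_interval`,
  after moving the base point of `Γ` off `closure Ω`, `exists_param_not_mem_closure`).
* `not_joinedIn_of_traverse` — **the traverse cuts the corner off the far arc**: no point joined
  to `c` in `closure Ω ∖ Γ[u, v]` is joined there to a point of `A₀` — Newman's cross-cut theorem
  (`Newman1939_crosscut_holds`, `JordanDomain.inter_nonempty_of_crosscut`): the sub-arc `Γ[u, v]`
  is a cross-cut of `Ω` between interior points of `A₁` and `A₂`, and `c`, `A₀` lie on the two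
  boundary arcs it cuts off.
* `MarkedDomain.exists_corner_params`, `MarkedDomain.exists_traverse_cut` — the same for the corner
  `pt (i + 2) = arc (i + 1) ∩ arc (i + 2)` of a `3`-marked Jordan domain, packaged as a `Path`
  along `Γ`, in `closure Ω`, from `arc (i + 1)` to `arc (i + 2)`, cutting every point joined to the
  corner off `Γ` from `arc i` (the form consumed by separating events of percolation crossings,
  Bollobás–Riordan, *Percolation* (2006), Ch. 7 §7.2.4 and proof of Claim 22, p. 198).

## References
* B. Bollobás, O. Riordan, *Percolation*, CUP (2006), Ch. 7 p. 198. [BollobasRiordan2006]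
* M. H. A. Newman, *Elements of the topology of plane sets of points* (1939), Ch. V §11,
  Thms. 11·7–11·8. [Newman1939]
-/

noncomputable section

namespace Literature.Topology.PlaneTopology

open Set Metric Filter Function _root_.Topology
open Literature.Probability.RandomPlanarGeometry

/-! ### Jordan loops: periods, base points, sub-arcs -/

namespace IsJordanLoop

variable {Γ : ℝ → ℂ}

/-- A Jordan loop is injective on every period `[s, s + 1)`. [folklore] -/
theorem injOn_Ico_add_one (h : IsJordanLoop Γ) (s : ℝ) : InjOn Γ (Ico s (s + 1)) := by
  intro u hu u' hu' heq
  have hfr : ∀ x, Γ (Int.fract x) = Γ x := fun x => by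
    rw [Int.fract, show x - (⌊x⌋ : ℝ) = x - (⌊x⌋ : ℤ) * (1 : ℝ) by ring]
    exact h.periodic.sub_int_mul_eq ⌊x⌋
  have hff : Int.fract u = Int.fract u' :=
    h.injOn ⟨Int.fract_nonneg u, Int.fract_lt_one u⟩ ⟨Int.fract_nonneg u', Int.fract_lt_one u'⟩
      (by rw [hfr, hfr, heq])
  obtain ⟨z, hz⟩ := Int.fract_eq_fract.1 hff
  have hlt : |u - u'| < 1 := by
    rw [abs_lt]
    constructor <;> linarith [hu.1, hu.2, hu'.1, hu'.2]
  rw [hz] at hlt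
  have hz0 : z = 0 := by
    have : |z| < 1 := by exact_mod_cast hlt
    exact Int.abs_lt_one_iff.1 this
  rw [hz0] at hz
  simpa [sub_eq_zero] using hz

/-- Change of base point: `t ↦ Γ (t + t₀)` is again a Jordan loop. [folklore] -/
theorem comp_add_right (h : IsJordanLoop Γ) (t₀ : ℝ) : IsJordanLoop fun t => Γ (t + t₀) :=
  ⟨h.continuous.comp (continuous_id.add continuous_const),
    fun t => by simp only [add_right_comm t 1 t₀]; exact h.periodic (t + t₀),
    fun u hu u' hu' huu' => by
      have := h.injOn_Ico_add_one t₀ ⟨by linarith [hu.1], by linarith [hu.2]⟩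
        ⟨by linarith [hu'.1], by linarith [hu'.2]⟩ huu'
      linarith⟩

/-- Change of base point does not change the range. [folklore] -/
theorem range_comp_add_right (Γ : ℝ → ℂ) (t₀ : ℝ) : range (fun t => Γ (t + t₀)) = range Γ := by
  refine Subset.antisymm (range_subset_iff.2 fun t => mem_range_self _) (range_subset_iff.2 fun x => ?_)
  exact ⟨x - t₀, by simp⟩

/-- The inside depends only on the range. [folklore] -/
theorem inside_eq_of_range_eq {γ γ' : ℝ → ℂ} (h : range γ = range γ') : inside γ = inside γ' := by
  simp only [inside, h]

/-- The outside depends only on the range. [folklore] -/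
theorem outside_eq_of_range_eq {γ γ' : ℝ → ℂ} (h : range γ = range γ') :
    outside γ = outside γ' := by
  simp only [outside, h]

/-- A sub-arc `Γ[u, v]` (`u < v < u + 1`) of a Jordan loop is a simple arc from `Γ u` to `Γ v`.
[folklore] -/
theorem isSimpleArc_image_Icc (h : IsJordanLoop Γ) {u v : ℝ} (huv : u < v) (hvu : v < u + 1) :
    IsSimpleArc (Γ '' Icc u v) (Γ u) (Γ v) := by
  have h0 : (0 : ℝ) < v - u := sub_pos.2 huv
  have hmem : ∀ x ∈ Icc (0 : ℝ) 1, u + x * (v - u) ∈ Icc u v := fun x hx =>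
    ⟨by nlinarith [hx.1], by nlinarith [hx.2]⟩
  have hinj : InjOn Γ (Icc u v) := (h.injOn_Ico_add_one u).mono (Icc_subset_Ico_right hvu)
  refine ⟨fun x => Γ (u + x * (v - u)), (h.continuous.comp (by fun_prop)).continuousOn, ?_, ?_,
    by simp, by simp⟩
  · intro x hx x' hx' heq
    have h' := hinj (hmem x hx) (hmem x' hx') heq
    have : x * (v - u) = x' * (v - u) := by linarith
    exact mul_right_cancel₀ h0.ne' this
  · ext z
    constructor
    · rintro ⟨x, hx, rfl⟩
      exact ⟨_, hmem x hx, rfl⟩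
    · rintro ⟨y, hy, rfl⟩
      refine ⟨(y - u) / (v - u), ⟨div_nonneg (by linarith [hy.1]) h0.le,
        (div_le_one h0).2 (by linarith [hy.2])⟩, ?_⟩
      simp only
      congr 1
      field_simp
      ring

end IsJordanLoop

/-! ### The cross-cut traverse and its separation property -/

section Corner

variable (J : JordanDomain) {m₁ m m₃ : ℝ} {Γ : ℝ → ℂ}

/-- **Cross-cut traverse of a Jordan loop around a corner** (see the module docstring).
[cite: BollobasRiordan2006, Ch. 7 p. 198 (proof of Claim 22)] -/
theorem exists_traverse (h₁ : m₁ < m) (h₂ : m < m₃) (h₃ : m₃ < m₁ + 1) (hΓ : IsJordanLoop Γ)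
    (hin : J.boundary m ∈ IsJordanLoop.inside Γ)
    (hout : J.boundary '' Icc m₃ (m₁ + 1) ⊆ IsJordanLoop.outside Γ) :
    ∃ u v : ℝ, u < v ∧ v < u + 1 ∧ (∀ x ∈ Ioo u v, Γ x ∈ J.carrier) ∧
      ((Γ u ∈ J.boundary '' Icc m₁ m ∧ Γ v ∈ J.boundary '' Icc m m₃) ∨
       (Γ u ∈ J.boundary '' Icc m m₃ ∧ Γ v ∈ J.boundary '' Icc m₁ m)) := by
  obtain ⟨t₀, ht₀⟩ := exists_param_not_mem_closure J hΓ (J.boundary_mem_frontier m) hin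
  set Γs : ℝ → ℂ := fun t => Γ (t + t₀) with hΓs
  have hΓsJ : IsJordanLoop Γs := hΓ.comp_add_right t₀
  have hrange : range Γs = range Γ := IsJordanLoop.range_comp_add_right Γ t₀
  have hin' : J.boundary m ∈ IsJordanLoop.inside Γs := by
    rwa [IsJordanLoop.inside_eq_of_range_eq hrange]
  have hout' : J.boundary '' Icc m₃ (m₁ + 1) ⊆ IsJordanLoop.outside Γs := by
    rwa [IsJordanLoop.outside_eq_of_range_eq hrange]
  have h0 : Γs 0 ∉ closure J.carrier := by simpa [hΓs] using ht₀
  set A₁ : Set ℂ := J.boundary '' Icc m₁ m with hA₁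
  set A₂ : Set ℂ := J.boundary '' Icc m m₃ with hA₂
  have hA₁c : IsClosed A₁ := (isCompact_Icc.image J.continuous_boundary).isClosed
  have hA₂c : IsClosed A₂ := (isCompact_Icc.image J.continuous_boundary).isClosed
  have hcΓ : J.boundary m ∉ range Γ := hin.1
  have hA₀Γ : ∀ p ∈ J.boundary '' Icc m₃ (m₁ + 1), p ∉ range Γ := fun p hp => (hout hp).1
  have hdis : ∀ x, Γs x ∈ A₁ → Γs x ∈ A₂ → False := by
    rintro x ⟨θ, hθ, hθx⟩ ⟨θ', hθ', hθ'x⟩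
    have heq := J.injOn_boundary_Icc h₃ ⟨hθ.1, by linarith [hθ.2]⟩ ⟨by linarith [hθ'.1], hθ'.2⟩
      (hθx.trans hθ'x.symm)
    have hθm : θ = m := le_antisymm hθ.2 (heq ▸ hθ'.1)
    exact hcΓ (hrange ▸ ⟨x, by rw [← hθx, hθm]⟩)
  have hinΩ : ∀ x, Γs x ∈ closure J.carrier → Γs x ∉ A₁ → Γs x ∉ A₂ → Γs x ∈ J.carrier := by
    intro x hxcl hx1 hx2
    rw [closure_eq_self_union_frontier] at hxcl
    rcases hxcl with h | h
    · exact h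
    · rw [frontier_eq_union_three J h₁.le h₂.le] at h
      rcases h with (h | h) | h
      · exact absurd h hx1
      · exact absurd h hx2
      · exact absurd (hrange ▸ mem_range_self x) (hA₀Γ _ h)
  have hpos : ∀ x, 0 ≤ x → Γs x ∈ frontier J.carrier → 0 < x := by
    intro x hx hfr
    rcases eq_or_lt_of_le hx with rfl | h
    · exact absurd (frontier_subset_closure hfr) h0
    · exact h
  obtain ⟨s, hs, t, ht, hsA, htA, hseg⟩ :=
    exists_mem_mem_forall_uIcc_of_inside J h₁ h₂ h₃ hΓsJ h0 hin' hout'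
  have hsne : s ≠ t := fun hst => hdis s hsA (hst ▸ htA)
  rcases lt_or_gt_of_ne hsne with hst | hts
  · obtain ⟨u₁, v₁, hsu, huv, hvt, hu₁, hv₁, hioo⟩ := exists_trimmed_interval hΓsJ.continuous
      hA₁c hA₂c hst hsA htA fun x _ hx1 hx2 => hdis x hx1 hx2
    have hu₁pos : 0 < u₁ := hpos u₁ (hs.1.trans hsu) (by
      obtain ⟨θ, -, hθ⟩ := hu₁; rw [← hθ]; exact J.boundary_mem_frontier θ)
    refine ⟨u₁ + t₀, v₁ + t₀, by linarith, by linarith [ht.2], fun x hx => ?_, Or.inl ⟨hu₁, hv₁⟩⟩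
    have hx' : x - t₀ ∈ Ioo u₁ v₁ := ⟨by linarith [hx.1], by linarith [hx.2]⟩
    have hxcl : Γs (x - t₀) ∈ closure J.carrier :=
      hseg _ (by rw [uIcc_of_le hst.le]; exact ⟨hsu.trans hx'.1.le, hx'.2.le.trans hvt⟩)
    have := hinΩ (x - t₀) hxcl (hioo _ hx').1 (hioo _ hx').2
    simpa [hΓs] using this
  · obtain ⟨u₁, v₁, htu, huv, hvs, hu₁, hv₁, hioo⟩ := exists_trimmed_interval hΓsJ.continuous
      hA₂c hA₁c hts htA hsA fun x _ hx2 hx1 => hdis x hx1 hx2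
    have hu₁pos : 0 < u₁ := hpos u₁ (ht.1.trans htu) (by
      obtain ⟨θ, -, hθ⟩ := hu₁; rw [← hθ]; exact J.boundary_mem_frontier θ)
    refine ⟨u₁ + t₀, v₁ + t₀, by linarith, by linarith [hs.2], fun x hx => ?_, Or.inr ⟨hu₁, hv₁⟩⟩
    have hx' : x - t₀ ∈ Ioo u₁ v₁ := ⟨by linarith [hx.1], by linarith [hx.2]⟩
    have hxcl : Γs (x - t₀) ∈ closure J.carrier :=
      hseg _ (by rw [uIcc_of_ge hts.le]; exact ⟨htu.trans hx'.1.le, hx'.2.le.trans hvs⟩)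
    have := hinΩ (x - t₀) hxcl (hioo _ hx').2 (hioo _ hx').1
    simpa [hΓs] using this

/-- **The traverse cuts the corner off the far arc** (Newman's cross-cut theorem; see the module
docstring). [cite: Newman1939, Ch. V §11 Thms. 11·7–11·8] -/
theorem not_joinedIn_of_traverse (h₁ : m₁ < m) (h₂ : m < m₃) (h₃ : m₃ < m₁ + 1)
    (hΓ : IsJordanLoop Γ) (hcΓ : J.boundary m ∉ range Γ)
    (hA₀ : ∀ p ∈ J.boundary '' Icc m₃ (m₁ + 1), p ∉ range Γ)
    {u v : ℝ} (huv : u < v) (hvu : v < u + 1) (hΩ : ∀ x ∈ Ioo u v, Γ x ∈ J.carrier)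
    (hends : (Γ u ∈ J.boundary '' Icc m₁ m ∧ Γ v ∈ J.boundary '' Icc m m₃) ∨
      (Γ u ∈ J.boundary '' Icc m m₃ ∧ Γ v ∈ J.boundary '' Icc m₁ m))
    {w : ℂ} (hw : JoinedIn (closure J.carrier \ Γ '' Icc u v) (J.boundary m) w)
    {a : ℂ} (ha : a ∈ J.boundary '' Icc m₃ (m₁ + 1)) :
    ¬ JoinedIn (closure J.carrier \ Γ '' Icc u v) w a := by
  intro hwa
  set b := J.boundary with hb
  set L : Set ℂ := Γ '' Icc u v with hL
  have huL : Γ u ∈ L := ⟨u, left_mem_Icc.2 huv.le, rfl⟩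
  have hvL : Γ v ∈ L := ⟨v, right_mem_Icc.2 huv.le, rfl⟩
  have hLΓ : L ⊆ range Γ := image_subset_range _ _
  -- the two endpoints, ordered along the boundary
  obtain ⟨θ₁, hθ₁, θ₂, hθ₂, harc, h₁L, h₂L, hLends⟩ : ∃ θ₁ ∈ Icc m₁ m, ∃ θ₂ ∈ Icc m m₃,
      IsSimpleArc L (b θ₁) (b θ₂) ∧ b θ₁ ∈ L ∧ b θ₂ ∈ L ∧
        ∀ x ∈ Icc u v, x = u ∨ x = v → Γ x = b θ₁ ∨ Γ x = b θ₂ := by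
    have hsimple := hΓ.isSimpleArc_image_Icc huv hvu
    rcases hends with ⟨⟨θ₁, hθ₁, hθ₁u⟩, ⟨θ₂, hθ₂, hθ₂v⟩⟩ | ⟨⟨θ₂, hθ₂, hθ₂u⟩, ⟨θ₁, hθ₁, hθ₁v⟩⟩
    · refine ⟨θ₁, hθ₁, θ₂, hθ₂, by rw [hθ₁u, hθ₂v]; exact hsimple, hθ₁u ▸ huL, hθ₂v ▸ hvL, ?_⟩
      rintro x - (rfl | rfl)
      · exact Or.inl hθ₁u.symm
      · exact Or.inr hθ₂v.symm
    · refine ⟨θ₁, hθ₁, θ₂, hθ₂, by rw [hθ₁v, hθ₂u]; exact hsimple.symm, hθ₁v ▸ hvL,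
        hθ₂u ▸ huL, ?_⟩
      rintro x - (rfl | rfl)
      · exact Or.inr hθ₂u.symm
      · exact Or.inl hθ₁v.symm
  have hθ₁m : θ₁ < m := lt_of_le_of_ne hθ₁.2 fun h => hcΓ (hLΓ (h ▸ h₁L))
  have hmθ₂ : m < θ₂ := lt_of_le_of_ne hθ₂.1 fun h => hcΓ (hLΓ (h.symm ▸ h₂L))
  -- `L` is a cross-cut
  have hcross : J.IsCrosscut L (b θ₁) (b θ₂) := by
    refine ⟨harc, J.boundary_mem_frontier _, J.boundary_mem_frontier _, fun heq => ?_, ?_⟩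
    · have := J.injOn_boundary_Icc h₃ ⟨hθ₁.1, by linarith [hθ₁.2]⟩ ⟨by linarith [hθ₂.1], hθ₂.2⟩
        heq
      linarith
    · rintro p ⟨⟨x, hx, rfl⟩, hp⟩
      rcases eq_or_lt_of_le hx.1 with hxu | hxu
      · exact absurd (hLends x hx (Or.inl hxu.symm)) (by simpa [or_iff_not_imp_left] using hp)
      rcases eq_or_lt_of_le hx.2 with hxv | hxv
      · exact absurd (hLends x hx (Or.inr hxv)) (by simpa [or_iff_not_imp_left] using hp)
      exact hΩ x ⟨hxu, hxv⟩
  -- the far point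
  obtain ⟨θa, hθa, rfl⟩ := ha
  have hθ₂a : θ₂ < θa := lt_of_le_of_ne (hθ₂.2.trans hθa.1) fun h =>
    hA₀ _ ⟨θa, hθa, rfl⟩ (hLΓ (h ▸ h₂L))
  have hθa₁ : θa < θ₁ + 1 := by
    refine lt_of_le_of_ne (by linarith [hθa.2, hθ₁.1]) fun h => ?_
    have hθ₁eq : θ₁ = m₁ := by linarith [hθa.2, hθ₁.1]
    have hθaeq : θa = m₁ + 1 := by linarith
    refine hA₀ _ ⟨θa, hθa, rfl⟩ (hLΓ ?_)
    rw [hθaeq, hb, J.periodic_boundary, ← hθ₁eq]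
    exact h₁L
  -- the joining path from the corner to the far point
  set γ₁ := hw.somePath with hγ₁
  set γ₂ := hwa.somePath with hγ₂
  set P : Set ℂ := range γ₁ ∪ range γ₂ with hP
  have hPsub : P ⊆ closure J.carrier \ L := by
    rintro p (⟨t, rfl⟩ | ⟨t, rfl⟩)
    · exact hw.somePath_mem t
    · exact hwa.somePath_mem t
  have hPconn : IsPreconnected P := by
    have : P = range (γ₁.trans γ₂) := (Path.trans_range γ₁ γ₂).symm
    rw [this]
    exact (isConnected_range (γ₁.trans γ₂).continuous).isPreconnected
  have hcP : b m ∈ P := Or.inl ⟨0, γ₁.source⟩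
  have haP : b θa ∈ P := Or.inr ⟨1, γ₂.target⟩
  obtain ⟨p, hpP, hpL⟩ := J.inter_nonempty_of_crosscut Newman1939_crosscut_holds
    (hθ₁m.trans hmθ₂) (by linarith [hθ₂.2]) hcross hPconn (fun p hp => (hPsub hp).1)
    ⟨hθ₁m, hmθ₂⟩ hcP ⟨hθ₂a, hθa₁⟩ haP
  exact (hPsub hpP).2 hpL

end Corner

/-! ### The corner of a `3`-marked Jordan domain -/

/-- **Corner parameters of a `3`-marked domain.**  For `i : Fin 3`, the arcs `arc (i + 1)`,
`arc (i + 2)`, `arc i` are the images of consecutive parameter intervals `[m₁, m]`, `[m, m₃]`,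
`[m₃, m₁ + 1]` with `m₁ < m < m₃ < m₁ + 1`, the corner `pt (i + 2)` being `boundary m`
(periodicity of the boundary loop moves the wrap-around). [folklore] -/
theorem _root_.Literature.Probability.RandomPlanarGeometry.MarkedDomain.exists_corner_params
    (D : MarkedDomain 3) (i : Fin 3) :
    ∃ m₁ m m₃ : ℝ, m₁ < m ∧ m < m₃ ∧ m₃ < m₁ + 1 ∧ D.pt (i + 2) = D.boundary m ∧
      D.arc (i + 1) = D.boundary '' Icc m₁ m ∧ D.arc (i + 2) = D.boundary '' Icc m m₃ ∧
      D.arc i = D.boundary '' Icc m₃ (m₁ + 1) := by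
  have hper : ∀ u v : ℝ, D.boundary '' Icc (u + 1) (v + 1) = D.boundary '' Icc u v := by
    intro u v
    rw [← image_add_const_Icc, image_image]
    exact image_congr fun x _ => D.periodic_boundary x
  have h01 : D.mark 0 < D.mark 1 := D.strictMono_mark (by decide)
  have h12 : D.mark 1 < D.mark 2 := D.strictMono_mark (by decide)
  have h0 := (D.mark_mem 0).1
  have h2 := (D.mark_mem 2).2
  have n0 : D.nextMark 0 = D.mark 1 := D.nextMark_of_lt 0 (by decide)
  have n1 : D.nextMark 1 = D.mark 2 := D.nextMark_of_lt 1 (by decide)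
  have n2 : D.nextMark 2 = D.mark 0 + 1 := D.nextMark_of_not_lt 2 (by decide)
  have a0 : D.arc 0 = D.boundary '' Icc (D.mark 0) (D.mark 1) := by rw [MarkedDomain.arc, n0]
  have a1 : D.arc 1 = D.boundary '' Icc (D.mark 1) (D.mark 2) := by rw [MarkedDomain.arc, n1]
  have a2 : D.arc 2 = D.boundary '' Icc (D.mark 2) (D.mark 0 + 1) := by
    rw [MarkedDomain.arc, n2]
  have p1 : D.boundary (D.mark 0 + 1) = D.pt 0 := by rw [D.periodic_boundary]; rfl
  fin_cases i
  · refine ⟨D.mark 1, D.mark 2, D.mark 0 + 1, h12, by linarith, by linarith, rfl, a1, a2, ?_⟩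
    show D.arc 0 = _
    rw [a0, ← hper]
  · refine ⟨D.mark 2, D.mark 0 + 1, D.mark 1 + 1, by linarith, by linarith, by linarith, ?_, ?_,
      ?_, ?_⟩
    · show D.pt 0 = _
      rw [p1]
    · show D.arc 2 = _
      rw [a2]
    · show D.arc 0 = _
      rw [a0, ← hper]
    · show D.arc 1 = _
      rw [a1, ← hper]
  · refine ⟨D.mark 0, D.mark 1, D.mark 2, h01, h12, by linarith, rfl, ?_, ?_, ?_⟩
    · show D.arc 0 = _
      rw [a0]
    · show D.arc 1 = _
      rw [a1]
    · show D.arc 2 = _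
      rw [a2]

/-- **A Jordan loop around a corner of a `3`-marked Jordan domain yields a separating path**:
if the corner `pt (i + 2)` is inside the Jordan loop `Γ` and the far arc `arc i` outside, some
path along `Γ` inside `closure Ω`, from `arc (i + 1)` to `arc (i + 2)`, cuts every point joined to
the corner in `closure Ω ∖ Γ` off the arc `arc i` inside `closure Ω` (the continuum form of "an
open circuit around the corner contains an open `A_{i+1}`–`A_{i+2}` path separating `z` from
`Aᵢ`", Bollobás–Riordan, proof of Claim 22). [cite: BollobasRiordan2006, Ch. 7 p. 198 (proof of Claim 22)] -/
theorem _root_.Literature.Probability.RandomPlanarGeometry.MarkedDomain.exists_traverse_cut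
    (D : MarkedDomain 3) (i : Fin 3) {Γ : ℝ → ℂ} (hΓ : IsJordanLoop Γ)
    (hin : D.pt (i + 2) ∈ IsJordanLoop.inside Γ) (hout : D.arc i ⊆ IsJordanLoop.outside Γ) :
    ∃ (x y : ℂ) (L : Path x y), x ∈ D.arc (i + 1) ∧ y ∈ D.arc (i + 2) ∧ range L ⊆ range Γ ∧
      (∀ t, L t ∈ closure D.carrier) ∧
      ∀ w, JoinedIn (closure D.carrier \ range Γ) (D.pt (i + 2)) w →
        w ∉ range L ∧ ∀ a ∈ D.arc i, ¬ JoinedIn (closure D.carrier \ range L) w a := by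
  obtain ⟨m₁, m, m₃, h₁, h₂, h₃, hpt, harc₁, harc₂, harc₀⟩ := D.exists_corner_params i
  rw [hpt] at hin ⊢
  rw [harc₀] at hout ⊢
  rw [harc₁, harc₂]
  set J := D.toJordanDomain with hJ
  obtain ⟨u, v, huv, hvu, hΩ, hends⟩ := exists_traverse J h₁ h₂ h₃ hΓ hin hout
  obtain ⟨π, hπ⟩ := exists_path_range_eq_image hΓ.continuous huv
  have hcΓ : J.boundary m ∉ range Γ := hin.1
  have hA₀ : ∀ p ∈ J.boundary '' Icc m₃ (m₁ + 1), p ∉ range Γ := fun p hp => (hout hp).1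
  have hLcl : Γ '' Icc u v ⊆ closure J.carrier := by
    rintro _ ⟨x, hx, rfl⟩
    rcases eq_or_lt_of_le hx.1 with hxu | hxu
    · rw [← hxu]
      rcases hends with ⟨⟨θ, -, hθ⟩, -⟩ | ⟨⟨θ, -, hθ⟩, -⟩ <;> rw [← hθ] <;>
        exact frontier_subset_closure (J.boundary_mem_frontier θ)
    rcases eq_or_lt_of_le hx.2 with hxv | hxv
    · rw [hxv]
      rcases hends with ⟨-, ⟨θ, -, hθ⟩⟩ | ⟨-, ⟨θ, -, hθ⟩⟩ <;> rw [← hθ] <;>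
        exact frontier_subset_closure (J.boundary_mem_frontier θ)
    exact subset_closure (hΩ x ⟨hxu, hxv⟩)
  have key : ∀ w, JoinedIn (closure J.carrier \ range Γ) (J.boundary m) w →
      w ∉ Γ '' Icc u v ∧ ∀ a ∈ J.boundary '' Icc m₃ (m₁ + 1),
        ¬ JoinedIn (closure J.carrier \ Γ '' Icc u v) w a := by
    intro w hw
    refine ⟨fun h => hw.target_mem.2 (image_subset_range _ _ h), fun a ha => ?_⟩
    exact not_joinedIn_of_traverse J h₁ h₂ h₃ hΓ hcΓ hA₀ huv hvu hΩ hends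
      (hw.mono (sdiff_subset_sdiff_right (image_subset_range _ _))) ha
  rcases hends with ⟨hu, hv⟩ | ⟨hu, hv⟩
  · refine ⟨Γ u, Γ v, π, hu, hv, hπ ▸ image_subset_range _ _, fun t => hLcl (hπ ▸ ⟨t, rfl⟩), ?_⟩
    rw [hπ]
    exact key
  · refine ⟨Γ v, Γ u, π.symm, hv, hu, ?_, fun t => hLcl ?_, ?_⟩
    · rw [Path.symm_range, hπ]
      exact image_subset_range _ _
    · rw [← hπ, ← Path.symm_range]
      exact ⟨t, rfl⟩
    · rw [Path.symm_range, hπ]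
      exact key

end Literature.Topology.PlaneTopology
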